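import Summits.Ventures.DiscreteObjects.Hadamard.Order334NegaPair668
import Literature.Combinatorics.Designs.ItoArray

/-!
# An Ito-type (quasi-Williamson) H(668) has a signed automorphism of pair order 334; hence it yields a negaperiodic
# complementary pair of length 334 (kernel) — the converse side of `Order334NegaPair668`

Framing: lottery ticket; floor = certified bounds/negative ranges.

Cell pub-namedobj (venture DiscreteObjects), target (H), hadamard gen 19.  The Ito-type array
`I(A,B,C,D) = [[A,B,C,D],[−B,A,−D,C],[−Cᵀ,Dᵀ,Aᵀ,−Bᵀ],[−Dᵀ,−Cᵀ,Bᵀ,Aᵀ]]` on circulant `A, B, C, D` of order `n`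
(`Literature.Combinatorics.Designs.ItoArray.itoMatrix`, Balonin–Đoković 2015 §9; the Williamson array is the symmetric sub-case)
carries, for ANY first rows `a, b, c, d`, the signed permutation symmetry
`σ : (p, i) ↦ (p̄, i + 1)` on rows and on columns, `p̄` = the block swap `(0 1)(2 3)`, with block signs `(+, −, +, −)`
(**`itoMatrix_shiftSwap_entry`**, **`itoMatrix_signedAut_shiftSwap`**: `I (σ x) (σ y) = s x · s y · I x y`); at `n = 167` the
pair `(σ, σ)` has order `334` (**`hadamard668_itoType_aut334`**).  Consequently (**`negaPair_of_itoType668`**, with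
`negaPair_of_hadamard668_orderOf_334`): an Ito-type Hadamard matrix of order `668` yields two antiperiodic `±1` sequences on
`ZMod 668` with autocorrelation sum `0` off `{0, 334}` — a negaperiodic complementary (Golay) pair of length `334`.  This is the
kernel form of one direction of [Balonin–Đoković 2015 §9: Ito-type H(4t) ⇔ NPAF Golay pairs of length 2t], obtained through the
automorphism rather than by the explicit interleaving; together with `Order334NegaPair668` it places PLAN-H's families F1
(Williamson) ⊂ F9 (Ito) INSIDE the order-334 line of the automorphism census.  Structure only; H(668) untouched; ours; no `sorry`,
no definitions (σ and the signs are written as terms).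
-/

namespace Summit.Ventures.DiscreteObjects.Hadamard

open Finset BigOperators Matrix

open Literature.Combinatorics.Designs.GoethalsSeidel (IsHadamardMatrix circT)
open Literature.Combinatorics.Designs.LegendrePairs (PAF IsPM)
open Literature.Combinatorics.Designs.ItoArray (itoMatrix itoBlocks)

/-- values of the block swap `(0 1)(2 3)` on `Fin 4` -/
lemma swap01_swap23_apply :
    (Equiv.swap (0 : Fin 4) 1 * Equiv.swap (2 : Fin 4) 3) 0 = 1 ∧ (Equiv.swap (0 : Fin 4) 1 * Equiv.swap (2 : Fin 4) 3) 1 = 0 ∧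
    (Equiv.swap (0 : Fin 4) 1 * Equiv.swap (2 : Fin 4) 3) 2 = 3 ∧ (Equiv.swap (0 : Fin 4) 1 * Equiv.swap (2 : Fin 4) 3) 3 = 2 := by
  decide

/-- the block swap is an involution -/
lemma swap01_swap23_sq : (Equiv.swap (0 : Fin 4) 1 * Equiv.swap (2 : Fin 4) 3) ^ 2 = 1 := by decide

section ito
variable {n : ℕ}

/-- **The shift–swap symmetry of the Ito-type array, entrywise.**  For all first rows `a, b, c, d : ZMod n → ℤ`, with
`σ (p, i) = ((0 1)(2 3) p, i + 1)` and block signs `s = (+1, −1, +1, −1)`: `I (σ x) (σ y) = s x · s y · I x y`. -/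
theorem itoMatrix_shiftSwap_entry (a b c d : ZMod n → ℤ) (x y : Fin 4 × ZMod n) :
    itoMatrix a b c d
      ((Equiv.prodCongr (Equiv.swap (0 : Fin 4) 1 * Equiv.swap (2 : Fin 4) 3) (Equiv.addRight (1 : ZMod n))) x)
      ((Equiv.prodCongr (Equiv.swap (0 : Fin 4) 1 * Equiv.swap (2 : Fin 4) 3) (Equiv.addRight (1 : ZMod n))) y) =
      (![1, -1, 1, -1] : Fin 4 → ℤ) x.1 * (![1, -1, 1, -1] : Fin 4 → ℤ) y.1 * itoMatrix a b c d x y := by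
  obtain ⟨hs0, hs1, hs2, hs3⟩ := swap01_swap23_apply
  obtain ⟨p, i⟩ := x
  obtain ⟨q, j⟩ := y
  simp only [Equiv.prodCongr_apply, Prod.map_apply, Equiv.coe_addRight]
  fin_cases p <;> fin_cases q <;>
    simp only [Fin.zero_eta, Fin.mk_one, Fin.isValue, Fin.reduceFinMk, hs0, hs1, hs2, hs3, itoMatrix, Matrix.of_apply,
      itoBlocks, circT, Matrix.cons_val_zero, Matrix.cons_val_one, Matrix.cons_val, Matrix.neg_apply,
      Matrix.circulant_apply, add_sub_add_right_eq_sub, neg_sub, one_mul, mul_one, neg_mul, mul_neg, neg_neg]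

/-- **The shift–swap is a signed automorphism of the Ito-type array** (any first rows). -/
theorem itoMatrix_signedAut_shiftSwap (a b c d : ZMod n → ℤ) :
    IsSignedAut (itoMatrix a b c d)
      (Equiv.prodCongr (Equiv.swap (0 : Fin 4) 1 * Equiv.swap (2 : Fin 4) 3) (Equiv.addRight (1 : ZMod n)))
      (Equiv.prodCongr (Equiv.swap (0 : Fin 4) 1 * Equiv.swap (2 : Fin 4) 3) (Equiv.addRight (1 : ZMod n)))
      (fun x => (![1, -1, 1, -1] : Fin 4 → ℤ) x.1) (fun x => (![1, -1, 1, -1] : Fin 4 → ℤ) x.1) := by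
  have hpm : ∀ p : Fin 4, (![1, -1, 1, -1] : Fin 4 → ℤ) p = 1 ∨ (![1, -1, 1, -1] : Fin 4 → ℤ) p = -1 := by decide
  exact ⟨fun x => hpm x.1, fun x => hpm x.1, fun x y => itoMatrix_shiftSwap_entry a b c d x y⟩

/-- powers of the shift–swap: `σ^k (p, i) = (swap^k p, i + k)` -/
lemma shiftSwap_pow_apply (k : ℕ) (x : Fin 4 × ZMod n) :
    ((Equiv.prodCongr (Equiv.swap (0 : Fin 4) 1 * Equiv.swap (2 : Fin 4) 3) (Equiv.addRight (1 : ZMod n))) ^ k) x =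
      (((Equiv.swap (0 : Fin 4) 1 * Equiv.swap (2 : Fin 4) 3) ^ k) x.1, x.2 + k) := by
  induction k generalizing x with
  | zero => simp
  | succ k ih =>
    rw [pow_succ', Equiv.Perm.mul_apply, ih, pow_succ', Equiv.Perm.mul_apply, Nat.cast_succ, ← add_assoc]
    rfl

end ito

/-- **An Ito-type H(668) has a signed automorphism of pair order 334.**  For any first rows `a, b, c, d : ZMod 167 → ℤ` the
shift–swap `σ` is a signed automorphism of `itoMatrix a b c d` with `orderOf (σ, σ) = 334`, on `668 = |Fin 4 × ZMod 167|`
points (no hypothesis on the rows is needed for the symmetry itself). -/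
theorem hadamard668_itoType_aut334 (a b c d : ZMod 167 → ℤ) :
    ∃ (σ : Equiv.Perm (Fin 4 × ZMod 167)) (s : Fin 4 × ZMod 167 → ℤ),
      IsSignedAut (itoMatrix a b c d) σ σ s s ∧ Fintype.card (Fin 4 × ZMod 167) = 668 ∧
      orderOf ((σ, σ) : Equiv.Perm (Fin 4 × ZMod 167) × Equiv.Perm (Fin 4 × ZMod 167)) = 334 := by
  refine ⟨_, _, itoMatrix_signedAut_shiftSwap a b c d, by simp [ZMod.card], ?_⟩
  set σ : Equiv.Perm (Fin 4 × ZMod 167) :=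
    Equiv.prodCongr (Equiv.swap (0 : Fin 4) 1 * Equiv.swap (2 : Fin 4) 3) (Equiv.addRight (1 : ZMod 167)) with hσ
  have h334 : σ ^ 334 = 1 := by
    ext x
    · rw [hσ, shiftSwap_pow_apply, show (334 : ℕ) = 2 * 167 from rfl, pow_mul, swap01_swap23_sq, one_pow]; rfl
    · rw [hσ, shiftSwap_pow_apply, Equiv.Perm.one_apply, show ((334 : ℕ) : ZMod 167) = 0 from by decide, add_zero]
  have h2 : σ ^ 2 ≠ 1 := by
    intro h
    have h' := congrArg (fun ρ : Equiv.Perm (Fin 4 × ZMod 167) => (ρ ((0 : Fin 4), (0 : ZMod 167))).2) h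
    simp only [hσ, shiftSwap_pow_apply, Equiv.Perm.one_apply, zero_add] at h'
    exact absurd h' (by decide)
  have h167 : σ ^ 167 ≠ 1 := by
    intro h
    have h' := congrArg (fun ρ : Equiv.Perm (Fin 4 × ZMod 167) => (ρ ((0 : Fin 4), (0 : ZMod 167))).1) h
    simp only [hσ, shiftSwap_pow_apply, Equiv.Perm.one_apply] at h'
    rw [show (167 : ℕ) = 2 * 83 + 1 from rfl, pow_add, pow_mul, swap01_swap23_sq, one_pow, one_mul, pow_one,
      swap01_swap23_apply.1] at h'
    exact absurd h' (by decide)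
  -- orderOf (σ, σ) = 334: a divisor of 334 = 2 · 167 that divides neither 2 nor 167
  set x : Equiv.Perm (Fin 4 × ZMod 167) × Equiv.Perm (Fin 4 × ZMod 167) := (σ, σ) with hx
  have hx334 : x ^ 334 = 1 := by rw [hx, Prod.pow_mk, h334]; rfl
  have hdvd : orderOf x ∣ 334 := orderOf_dvd_of_pow_eq_one hx334
  have hmem : orderOf x ∈ Nat.divisors 334 := Nat.mem_divisors.mpr ⟨hdvd, by norm_num⟩
  have hdiv : Nat.divisors 334 = {1, 2, 167, 334} := by decide
  rw [hdiv] at hmem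
  simp only [Finset.mem_insert, Finset.mem_singleton] at hmem
  have hne2 : ¬ orderOf x ∣ 2 := by
    intro h
    have h1 : x ^ 2 = 1 := orderOf_dvd_iff_pow_eq_one.mp h
    rw [hx, Prod.pow_mk, Prod.mk_eq_one] at h1
    exact h2 h1.1
  have hne167 : ¬ orderOf x ∣ 167 := by
    intro h
    have h1 : x ^ 167 = 1 := orderOf_dvd_iff_pow_eq_one.mp h
    rw [hx, Prod.pow_mk, Prod.mk_eq_one] at h1
    exact h167 h1.1
  rcases hmem with h | h | h | h
  · exact absurd (by rw [h]; exact one_dvd 2) hne2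
  · exact absurd (by rw [h]) hne2
  · exact absurd (by rw [h]) hne167
  · exact h

/-- **Ito-type H(668) ⇒ a negaperiodic complementary pair of length 334.**  If the Ito-type array on circulant first rows
`a, b, c, d : ZMod 167 → ℤ` is a Hadamard matrix (of order `668`), there are two antiperiodic `±1` sequences on `ZMod 668`
whose periodic autocorrelations cancel off `{0, 334}`. -/
theorem negaPair_of_itoType668 (a b c d : ZMod 167 → ℤ) (hI : IsHadamardMatrix (itoMatrix a b c d)) :
    ∃ u v : ZMod 668 → ℤ, IsPM u ∧ IsPM v ∧ (∀ t, u (t + 334) = -u t) ∧ (∀ t, v (t + 334) = -v t) ∧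
      ∀ s : ZMod 668, s ≠ 0 → s ≠ 334 → PAF u s + PAF v s = 0 := by
  obtain ⟨σ, sg, haut, hcard, hord⟩ := hadamard668_itoType_aut334 a b c d
  exact negaPair_of_hadamard668_orderOf_334 hI hcard σ σ sg sg haut hord

end Summit.Ventures.DiscreteObjects.Hadamard
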